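import Summits.BirchSwinnertonDyer.Rank1Residual.ManinAdditive.JumpDegreeLaws
import Summits.BirchSwinnertonDyer.Rank1Residual.ManinAdditive.HurwitzBrandtTwoEisenstein
import HarnessLib
import HarnessLib.Audit.Tags

/-!
# The θ-BRANDT (additive Ribet–Takahashi) degree law at `4 ∥ N` and its mod-3 shadow: rows E-desc-116 / 117 / 118 typed
# (cell `bsd-f2-manin`, desc g17, MEMO-desc §35; nothing asserted)

SKETCH (planner bsd-f2-manin-desc g17).  Engine + census: `HOME/desc/g17/` (`brandt_theta.py`, `eis3.py`, `big3.py`,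
`BT-census-g17.md`, `SHA16SUMS.desc.g17`).

THE OBJECT (§2 below, computable at PRIME `M = p`; general odd `M` is definition request D-desc-25).  `B = B_{2,∞}`, `O` the
Hurwitz order, `𝔓 = (1+i)` its prime over `2`, `O/𝔓 = 𝔽₄`, `θ : (O/𝔓)^× = 𝔽₄^× → μ₃ ⊂ ℤ[ω]^×` the identity character.
For odd `M` let `P_M = ℙ¹(ℤ/M)` with its left `O^×`-action (`O ⊗ ℤ/M ≅ M₂(ℤ/M)`); `O^×/±1 ≅ A₄ = V₄ ⋊ C₃` and `θ` is trivial
exactly on `V₄ = {1, i, j, k}`.  The θ-BRANDT MODULE of level `4M` is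
  `𝓜_θ(M) = {m : P_M → ℤ[ω] : m(u·x) = θ(u) m(x) for all u ∈ O^×}`
(so `m` vanishes on the points whose stabiliser contains an element of order 3; the SUPPORT is the set of `A₄`-orbits
with stabiliser `⊂ V₄`, of order `w ∈ {1, 2}`), with the Hecke operators
  `(T_ℓ m)(y) = Σ_{γ ∈ O^×\O_ℓ, [γ x] = [y]} θ(phase) m(x)` (push-forward of θ-twisted divisors; `O_ℓ` = elements of
reduced norm `ℓ`, `ℓ ∤ 2M` prime), and the GROSS HEIGHT `⟨m, m⟩ = Σ_{orbits o} w_o · Nm(m_o)` (`w_o` = order of the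
stabiliser in `A₄`; the Gross / Pollack–Weston normalisation `⟨e_i, e_j⟩ = δ_ij w_i`).  By Jacquet–Langlands + the local
theory at `2` (the newforms of level `4` at `2` with trivial character are exactly the depth-zero supercuspidals
`Ind(θ̃)` from `O_𝔓^× ⊃ 1 + 𝔓`), `𝓜_θ(M) ⊗ ℂ ≅ S₂(Γ₀(4M))^{4M-new}` as Hecke modules — CHECKED: `#supp(M) =
dim S₂^{new}(Γ₀(4M))` at all 492 odd levels `5 ≤ M ≤ 1445` of the census (`DIMOK` column).  For the newform `f = f_E` of an
elliptic curve of conductor `4M` the `f`-eigenline of `𝓜_θ(M)` is a free `ℤ[ω]`-module of rank 1 (multiplicity one, 1717/1717);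
`m_E` = a primitive generator, `ξ_θ(E) := ⟨m_E, m_E⟩ ∈ ℕ` (independent of the unit).

THE LAW (E-desc-117, `ThetaBrandtDegreeLawAtFourPrime` below at prime `M`; all odd `M` in the census):  for the
`X₀(N)`-OPTIMAL curve `E`, `N = 4M`, `M` odd (Kodaira IV or IV* at 2):
  `deg φ_E = 2^{a(E)} · 3^{1 − t(E)} · ξ_θ(E)`,
  `a(E) = 0` if `E` is IV at `2`; `a(E) = 1` if IV* and `E(ℚ)[2] = 0`; `a(E) = −1` if IV* and `E(ℚ)[2] ≠ 0`
  (the last case lives on the levels `4(s²+4)`, E-desc-106);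
  `t(E) = 1` iff `E` is 3-EISENSTEIN-DEGENERATE (`IsThreeEisensteinDegenerateAtFour`): `E(ℚ)[3] ≠ 0`, `3 ∤ c_p(E)` for every
  odd `p ∣ N`, and `p ≡ 2 (mod 3)` for every odd `p ∥ N` (⟺ a rational point of order 3 lies in `E⁰(ℚ_p)` for every odd `p`
  and every multiplicative prime is non-split); else `t(E) = 0`.
CENSUS (BC5 witness, `BT-census-g17.md`): all 1717 optimal curves with `4 ∥ N`, `N ≤ 5780` (`M ≤ 1445`, 17 levels
uncovered by the 58 s in-seat budget listed there): `deg φ / ξ_θ ∈ {3, 1} (IV: 981 / 9), {6, 2} (IV*, no 2-torsion: 706 / 10),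
{3/2, 1/2} (IV*, 2-torsion: 10 / 1)}`, the second value of each pair occurring EXACTLY on the 20 3-Eisenstein-degenerate
curves (20a1, 36a1, 44a1, 92a1, 108a1, 116b1, 236b1, 324a1, 324d1, 404b1, 540a1, 612a1, 1620b1, 1660a1, 2636a1, 3564b1,
3852b1, 5380a1, 5620a1, 5724a1); no prime `≥ 5` and no other power of 2 or 3 ever occurs in the ratio: 0 / 1717 violations.
So `ord_ℓ deg φ = ord_ℓ ξ_θ(E)` for every `ℓ ≥ 5` — the ADDITIVE analogue at the supercuspidal prime 2 of the definite
Ribet–Takahashi / Pollack–Weston formula `ord_p δ_f = ord_p ξ_f(N⁺,N⁻) + Σ_{q ∣ N⁻} t_f(q)` (tree: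
`PollackWeston2011.thm_6_8_ellipticCurve`, squarefree `N`, `p` odd, `ρ̄` surjective), with the Tamagawa exponents at the
ramified prime replaced by the two EXPLICIT local corrections `a(E)` (at `ℓ = 2`: the inseparability dichotomy of THEOREM
L / row E-desc-41) and `1 − t(E)` (at `ℓ = 3`: the index `[O_𝔓^× : ℤ₂^×(1+𝔓)] = 3 = #𝔽₄^×/#𝔽₂^×`, removed exactly when
`m_E` is EISENSTEIN mod `λ = 1 − ω`, i.e. `m_E ≡ c · w^{-1} (mod λ)` — E-blind criterion, `eis3.py`, agreeing with `t(E)` on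
every 3-torsion curve of the census).  The generic `3` is NOT `ord₃ c₂` (454 IV curves with `c₂ = 1` have ratio 3).

THE MOD-3 SHADOW (E-desc-116, `ThreeFreeDegreeLawAtFour`, E-facing, no Brandt module): `3 ∤ deg φ_E ⟹ t(E) = 1`.
CENSUS over the whole Cremona table: 168 649 optimal curves with `4 ∥ N < 5·10⁵`; exactly 26 have `3 ∤ deg φ`
(20a1, 36a1, 44a1, 92a1, 116b1, 236b1, 404b1, 2636a1, 7892a1, 8108a1, 17684a1, 21188b1, 21404a1, 32876a1, 43796b1, 44012a1,
54764a1, 85076a1, 85292a1, 124892a1, 125108a1, 127892a1, 128108a1, 390332b1, 405116a1, 405332a1) and ALL 26 are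
3-Eisenstein-degenerate (0 violations; 84 curves in range are degenerate, the other 58 having `3 ∣ ξ_θ`).  Mechanism: `θ ≡ 1
(mod λ)`, so `𝓜_θ(M)/λ` embeds Hecke-equivariantly into the trivial-character Hurwitz–Brandt module mod 3 (level `2M` and
`M` forms + Eisenstein): `f_E` is congruent mod 3 to a form of level dividing `2M` — for `ρ̄_{E,3}` irreducible and `9 ∤ N`
this half is IN PRINT up to assembly (Ribet's level lowering at `ℓ = 2 ≠ 3`: the tame type of order 3 at 2 is unipotent mod 3,
+ Agashe–Ribet–Stein `ord₃ deg φ = ord₃ r_E` for `9 ∤ N`); the content beyond print is the Eisenstein case (`ρ̄_{E,3}`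
reducible: 3 ∤ deg φ forces the torsion point into `E⁰` at every odd prime and non-split multiplicative reduction
everywhere) and the levels `9 ∣ N`.

PARTITION currency: rows about `deg φ` (MS-ii side), optimal curves, `4 ∥ N`; beyond-print theorem: NO (laws + census);
BSD is not proved by this.

TYPER NOTE (typer g17, T-desc-27).  SOURCE = HOME/desc/g17/Sketch-desc-g17.lean sha16 9025322b136025d5 (439 l.; farm rc 0 · 0 err ·
0 warn · 0 sorry per desc, check-g17.json; BC7 6/6 CLEAN), landed VERBATIM except: (i) this note; (ii) namespace `…ManinAdditive.DescG17`
folded to `…ManinAdditive.ThetaBrandt`; (iii) the 400-line cap: §1–§2 (all definitions and the rows E-desc-116 `ThreeFreeDegreeLawAtFour`,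
E-desc-116♯ `ThreeFreeDegreeIffAtFourPrime`, E-desc-116b `ThreeDvdDegreeAtFourComposite`, E-desc-117♭ `ThetaBrandtNewLineAtFourPrime`,
E-desc-117 `ThetaBrandtDegreeLawAtFourPrime`, E-desc-118 `ThetaEisensteinCriterionAtFourPrime` + the §1 edges) are THIS file, §3 (the
additive Ribet–Takahashi edge `padicValNat_modularDegree_eq_of_thetaBrandtDegreeLaw` and the kernel certificates `thetaExp_generators`,
`stabWeight_five/thirteen`, `g44…`) is the sibling `ThetaBrandtDegreeLawsEdges.lean`; (iv) the `Ribet1990` locator is marked «per desc,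
source not held by the cell (acq-09883)».  BC5 = HOME/desc/g17/BT-census-g17.md (1717 optimal IV/IV* curves, 5 ≤ M ≤ 1445: 0 violations of
E-117; 168 649 optimal curves 4 ∥ N < 5·10⁵: 26 with 3 ∤ deg φ, all 3-Eisenstein-degenerate).  REFUTER: R-desc-27 (ref1) §R130:
SURVIVES ×6, KILLED 0 (by name, PH130 11/11 axioms; engine r130 = desc on every count).  TOUCH typer g18 (T-desc-30): the E-desc-116
docstring's level-lowering cite corrected per §R130 (c) (Ribet 1990 Thm 1.1 → DarmonDiamondTaylor1995 Thm 3.15; desc's 18-line diff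
T-desc-30-citefix.diff c8f08ed710d923b5, no declaration text changed) and the assembly edge `isThreeEisensteinDegenerate_of_pair` appended.  bears_on: stmt-BirchSwinnertonDyer-22967 (C2) via deg φ at 4 ∥ N.  BSD is not proved by this; C2/C3 OPEN.
-/

open scoped MatrixGroups ModularForm

open CongruenceSubgroup WeierstrassCurve Literature.NumberTheory.EllipticCurves.ModularForms

open Summit.BirchSwinnertonDyer.Rank1Residual.ManinAdditive.ConwayCut
open Summit.BirchSwinnertonDyer.Rank1Residual.ManinAdditive.RamanujanCut (HasRationalThreeTorsion)
open Summit.BirchSwinnertonDyer.Rank1Residual.ManinAdditive.JumpDegree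

noncomputable section

namespace Summit.BirchSwinnertonDyer.Rank1Residual.ManinAdditive.ThetaBrandt


/-! ### §1. The E-facing mod-3 shadow (row E-desc-116) -/

/-- The local Tamagawa number `c_p(E) = [E(ℚ_p) : E⁰(ℚ_p)]` at a rational prime `p` (tree `localTamagawaNumber` on the
`ℤ_p`-minimal model of the base change; junk value `1` at a non-prime). [folklore] -/
def tamagawaAt (W : WeierstrassCurve ℚ) (p : ℕ) : ℕ :=
  if hp : p.Prime then
    (haveI : Fact p.Prime := ⟨hp⟩
     (W.baseChange ℚ_[p]).localTamagawaNumber ℤ_[p])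
  else 1

/-- **3-Eisenstein degeneracy at `4 ∥ N`** (desc g17 criterion `t(E) = 1`): `E(ℚ)[3] ≠ 0`; `3 ∤ c_p(E)` for every odd
prime `p ∣ N`; and every odd prime `p ∥ N` is `≡ 2 (mod 3)`.  (Given the first two clauses the third says: every
multiplicative prime is NON-split — a point of order 3 in `E⁰(ℚ_p)` reduces into `Ẽ_ns(𝔽_p)` of order `p ∓ 1`; additive odd
`p ≠ 3` and `p = 3` multiplicative violate the second clause automatically, so no case distinction is needed.) [folklore] -/
def IsThreeEisensteinDegenerateAtFour (W : WeierstrassCurve ℚ) : Prop :=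
  HasRationalThreeTorsion W ∧
    ∀ p : ℕ, p.Prime → p ≠ 2 → p ∣ W.conductorNorm ℤ →
      ¬ 3 ∣ tamagawaAt W p ∧ (¬ p ^ 2 ∣ W.conductorNorm ℤ → p % 3 = 2)

/-- **Row E-desc-116 `ThreeFreeDegreeLawAtFour` (LAW with mechanism; cell bsd-f2-manin, desc g17, MEMO-desc §35; nothing
asserted).**  An `X₀(N)`-optimal curve (lattice clause + minimal-degree clause, as in `ConwayKodairaLaws` /
`JumpDegreeLaws`) with `4 ∥ N` whose modular degree is prime to `3` is 3-Eisenstein-degenerate.  Census (BC5 witness):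
168 649 optimal curves with `4 ∥ N < 5·10⁵`, 26 with `3 ∤ deg φ`, all 26 degenerate, 0 violations (`big3.py`,
`BT-census-g17.md` §3).  = the mod-`λ` shadow of the θ-Brandt degree law E-desc-117 (`3^{1−t(E)} ∣ deg φ`).  Why it might
fail: an optimal curve at a level `4M` with `9 ∣ M` or with `ρ̄_{E,3}` reducible where the congruence `f_E ≡ (level 2M)
mod 3` forced by `θ ≡ 1 (mod 1 − ω)` is absorbed by `r_E / deg φ` (Agashe–Ribet–Stein allow `ord₃ r_E > ord₃ deg φ` when
`9 ∣ N`) — none below `5·10⁵`.  In print: the sub-case `ρ̄_{E,3}` irreducible, `9 ∤ N` follows from weight-2 level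
optimisation mod `ℓ = 3` removing one factor `2` (Darmon–Diamond–Taylor 1995 Thm. 3.15 = Diamond 1995 with Carayol 1989:
`cond₂ ρ̄_{E,3} = 1` because `ρ̄_{E,3}(I₂)` is unipotent of order `3` at Kodaira IV/IV*; the `ℚ(√−3)`-proviso is automatic)
with Agashe–Ribet–Stein 2012 Thm. 2.1 (referee §R130 (c)); the Eisenstein case and `9 ∣ N` are the cell's.
[cite: AgasheRibetStein2012, Thm. 2.1 (deg φ ∣ r_E, and ord_p equality for p² ∤ N — the assembly step of the irreducible sub-case; the law is the cell's row E-desc-116, MEMO-desc §35, NOT in print)]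
[cite: DarmonDiamondTaylor1995, Thm. 3.15 (weight-two level optimisation mod ℓ = 3: a newform g with N_g = N(ρ̄)·ℓ^δ, i.e. one factor 2 removed since cond₂ ρ̄₃ = 1; hypothesis «ρ̄ restricted to ℚ(√−3) absolutely irreducible» automatic because ρ̄₃(I₂) has order 3 — shape of the irreducible sub-case only; referee ref1 §R130 (c))] -/
@[conjecture]
def ThreeFreeDegreeLawAtFour : Prop :=
  ∀ (W : WeierstrassCurve ℚ) [W.IsElliptic] [W.IsGloballyMinimal] [NeZero (W.conductorNorm ℤ)]
    (D : ModularParametrizationData W (W.conductorNorm ℤ)),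
    (∀ z ∈ D.L.lattice, ∃ w ∈ periodLattice D.f, z = D.c * w) →
    (∀ (W' : WeierstrassCurve ℚ) [W'.IsElliptic]
        (D' : ModularParametrizationData W' (W.conductorNorm ℤ)),
        D'.f = D.f → D.modularDegree ≤ D'.modularDegree) →
    padicValNat 2 (W.conductorNorm ℤ) = 2 → ¬ 3 ∣ D.modularDegree → IsThreeEisensteinDegenerateAtFour W

/-- **Row E-desc-116♯ `ThreeFreeDegreeIffAtFourPrime`** (LAW, the sharp form of E-desc-116 at PRIME Pizer level; E-facing,
no Brandt vocabulary). For an optimal curve of conductor `N = 4p`, `p ≥ 5` prime: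
`3 ∤ deg φ ⟺ IsThreeEisensteinDegenerateAtFour W` (`⟺ E(ℚ)[3] ≠ 0 ∧ 3 ∤ c_p ∧ p ≡ 2 (mod 3)`).
BC5 (big3-out.txt 481e5067ba7751f6, ALL 168 649 optimal curves with `4 ∥ N < 5·10⁵`): `⇒` 25/25 (every 3-free curve except
36a1 has `N = 4p`), `⇐` 25/25 (no degenerate curve with `N = 4p` has `3 ∣ deg φ`).  The 25 are EXACTLY (equal `c₄, c₆`)
the Hessian curves `y² + 2a·xy − 4y = x³` (IV*, `Δ = −2⁸(2a³ + 27)`, 16 curves: `a = 1, −2, −4, −7, ±10, 13, 16, −19, ±22, ±25,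
±37`, and `a = −1`: `2a³ + 27 = 5²`, 20a1) and `y² + 2a·xy − 2y = x³` (IV, `Δ = −2⁴(4a³ + 27)`, 9 curves: `a = −1, 2, ±11, ±14,
±20, 29`), and conversely EVERY member of the two pencils with `|2a³ + 27|` resp. `|4a³ + 27|` a prime `≡ 2 (mod 3)` and
`N < 5·10⁵` is optimal and 3-free (25 = 25 conductors; first predictions beyond the table: `N = 511892` (`a = −40`, IV*),
`685892` (`a = −35`, IV), `1102628`, `1102844`, `1124756`, `1124972`).  (`E(ℚ)[3] ≠ 0 ∧ N = 4p ∧ p ≡ 2 (3)` forces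
`a₃ ∈ {±2, ±4}` in the `X₁(3)`-model: for `a₃ = ±1, ±8` the cofactor `a₁² ∓ 3a₁c + 9c² ≡ 1 (mod 3)`.)
Brandt reading (E-desc-117/118): at prime Pizer level the Eisenstein-mod-`λ` line has `3 ∤ ξ_θ`.
Why it might fail: a degenerate `N = 4p` curve beyond `5·10⁵` with `3 ∣ ξ_θ` (a second, accidental Eisenstein congruence).
[cite: CremonaEcdata] [cite: AgasheRibetStein2012] [cite: Mazur1977] -/
@[conjecture]
def ThreeFreeDegreeIffAtFourPrime : Prop :=
  ∀ (p : ℕ), p.Prime → 5 ≤ p →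
  ∀ (W : WeierstrassCurve ℚ) [W.IsElliptic] [W.IsGloballyMinimal] [NeZero (W.conductorNorm ℤ)]
    (D : ModularParametrizationData W (W.conductorNorm ℤ)),
    W.conductorNorm ℤ = 4 * p →
    (∀ z ∈ D.L.lattice, ∃ w ∈ periodLattice D.f, z = D.c * w) →
    (∀ (W' : WeierstrassCurve ℚ) [W'.IsElliptic]
        (D' : ModularParametrizationData W' (W.conductorNorm ℤ)),
        D'.f = D.f → D.modularDegree ≤ D'.modularDegree) →
    (¬ 3 ∣ D.modularDegree ↔ IsThreeEisensteinDegenerateAtFour W)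

/-- **Row E-desc-116b `ThreeDvdDegreeAtFourComposite`** (LAW, E-blind, the composite-level half of the classification):
an optimal curve with `4 ∥ N`, `N/4` composite and `N ≠ 36` has `3 ∣ deg φ`.
BC5 (big3-out.txt 481e5067ba7751f6): all optimal curves with `4 ∥ N < 5·10⁵` and `N/4` composite except 36a1
(`X₀(36) = 36a1`, `deg φ = 1`) — 0 exceptions; mechanism: generic `3 = [O_𝔓^× : ℤ₂^×(1+𝔓)]` when `t = 0` (E-desc-117), and
for `t = 1` at composite Pizer level a second (old, divisor-indexed) Eisenstein congruence mod 3 restores the factor (58/58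
degenerate composite-level curves have `3 ∣ deg φ`).  Why it might fail: a degenerate curve at composite `N/4 > 1.25·10⁵` whose
two Eisenstein congruences coalesce. [cite: CremonaEcdata] [cite: Ribet1990] -/
@[conjecture]
def ThreeDvdDegreeAtFourComposite : Prop :=
  ∀ (W : WeierstrassCurve ℚ) [W.IsElliptic] [W.IsGloballyMinimal] [NeZero (W.conductorNorm ℤ)]
    (D : ModularParametrizationData W (W.conductorNorm ℤ)),
    (∀ z ∈ D.L.lattice, ∃ w ∈ periodLattice D.f, z = D.c * w) →
    (∀ (W' : WeierstrassCurve ℚ) [W'.IsElliptic]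
        (D' : ModularParametrizationData W' (W.conductorNorm ℤ)),
        D'.f = D.f → D.modularDegree ≤ D'.modularDegree) →
    padicValNat 2 (W.conductorNorm ℤ) = 2 → ¬ (W.conductorNorm ℤ / 4).Prime → W.conductorNorm ℤ ≠ 36 →
    3 ∣ D.modularDegree

/-- The classification pair implies E-desc-116 away from `N = 36` at prime Pizer level (sanity edge). -/
theorem isThreeEisensteinDegenerate_of_iff_prime (h : ThreeFreeDegreeIffAtFourPrime) (p : ℕ) (hp : p.Prime) (h5 : 5 ≤ p)
    (W : WeierstrassCurve ℚ) [W.IsElliptic] [W.IsGloballyMinimal] [NeZero (W.conductorNorm ℤ)]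
    (D : ModularParametrizationData W (W.conductorNorm ℤ)) (hN : W.conductorNorm ℤ = 4 * p)
    (hΛ : ∀ z ∈ D.L.lattice, ∃ w ∈ periodLattice D.f, z = D.c * w)
    (hmin : ∀ (W' : WeierstrassCurve ℚ) [W'.IsElliptic] (D' : ModularParametrizationData W' (W.conductorNorm ℤ)),
        D'.f = D.f → D.modularDegree ≤ D'.modularDegree)
    (h3 : ¬ 3 ∣ D.modularDegree) : IsThreeEisensteinDegenerateAtFour W :=
  (h p hp h5 W D hN hΛ hmin).mp h3

/-- **The classification pair implies E-desc-116 away from `N ∈ {12, 36}`** (assembly edge, proved from the nodes; typer g18, landed with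
the T-desc-30 cite fix): E-desc-116♯ decides the prime Pizer levels `N = 4p`, `p ≥ 5`, and E-desc-116b makes the hypothesis `3 ∤ deg φ`
impossible at composite Pizer level `≠ 36`.  (`N = 12` is vacuous — `X₀(12)` has genus `0` — but is kept as a hypothesis; `N = 36` is
the one composite exception, `36a1`, which is degenerate by E-desc-116 itself.) -/
theorem isThreeEisensteinDegenerate_of_pair (hp : ThreeFreeDegreeIffAtFourPrime) (hc : ThreeDvdDegreeAtFourComposite)
    (W : WeierstrassCurve ℚ) [W.IsElliptic] [W.IsGloballyMinimal] [NeZero (W.conductorNorm ℤ)]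
    (D : ModularParametrizationData W (W.conductorNorm ℤ))
    (hΛ : ∀ z ∈ D.L.lattice, ∃ w ∈ periodLattice D.f, z = D.c * w)
    (hmin : ∀ (W' : WeierstrassCurve ℚ) [W'.IsElliptic] (D' : ModularParametrizationData W' (W.conductorNorm ℤ)),
        D'.f = D.f → D.modularDegree ≤ D'.modularDegree)
    (h2 : padicValNat 2 (W.conductorNorm ℤ) = 2) (h12 : W.conductorNorm ℤ ≠ 12) (h36 : W.conductorNorm ℤ ≠ 36)
    (h3 : ¬ 3 ∣ D.modularDegree) : IsThreeEisensteinDegenerateAtFour W := by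
  by_cases hprime : (W.conductorNorm ℤ / 4).Prime
  · have hN0 : W.conductorNorm ℤ ≠ 0 := NeZero.ne _
    have h4 : 2 ^ 2 ∣ W.conductorNorm ℤ := by
      have h := pow_padicValNat_dvd (p := 2) (n := W.conductorNorm ℤ)
      rwa [h2] at h
    have h8 : ¬ 2 ^ 3 ∣ W.conductorNorm ℤ := by
      have h := pow_succ_padicValNat_not_dvd (p := 2) hN0
      rwa [h2] at h
    have hN : W.conductorNorm ℤ = 4 * (W.conductorNorm ℤ / 4) := by
      obtain ⟨k, hk⟩ := h4
      omega
    have hp2 : W.conductorNorm ℤ / 4 ≠ 2 := by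
      intro h; apply h8; rw [hN, h]; norm_num
    have hp3 : W.conductorNorm ℤ / 4 ≠ 3 := by
      intro h; apply h12; rw [hN, h]
    exact (hp _ hprime (hprime.five_le_of_ne_two_of_ne_three hp2 hp3) W D hN hΛ hmin).mp h3
  · exact absurd (hc W D hΛ hmin h2 hprime h36) h3

/-- E-desc-116 ⇒ `3 ∣ deg φ` for every optimal curve with `4 ∥ N` and no rational 3-torsion (168 565 of the 168 649
optimal curves below `5·10⁵`; proved from the defs). -/
theorem three_dvd_modularDegree_of_not_hasRationalThreeTorsion (h : ThreeFreeDegreeLawAtFour)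
    (W : WeierstrassCurve ℚ) [W.IsElliptic] [W.IsGloballyMinimal] [NeZero (W.conductorNorm ℤ)]
    (D : ModularParametrizationData W (W.conductorNorm ℤ))
    (hΛ : ∀ z ∈ D.L.lattice, ∃ w ∈ periodLattice D.f, z = D.c * w)
    (hmin : ∀ (W' : WeierstrassCurve ℚ) [W'.IsElliptic]
        (D' : ModularParametrizationData W' (W.conductorNorm ℤ)),
        D'.f = D.f → D.modularDegree ≤ D'.modularDegree)
    (h2 : padicValNat 2 (W.conductorNorm ℤ) = 2) (hT : ¬ HasRationalThreeTorsion W) :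
    3 ∣ D.modularDegree := by
  by_contra hnd
  exact hT (h W D hΛ hmin h2 hnd).1

/-- E-desc-116 ⇒ `3 ∣ deg φ` for every optimal curve with `4 ∥ N` having an odd prime `q ∥ N` with `q ≢ 2 (mod 3)`
(a split-able multiplicative prime; proved from the defs). -/
theorem three_dvd_modularDegree_of_prime_not_two_mod_three (h : ThreeFreeDegreeLawAtFour)
    (W : WeierstrassCurve ℚ) [W.IsElliptic] [W.IsGloballyMinimal] [NeZero (W.conductorNorm ℤ)]
    (D : ModularParametrizationData W (W.conductorNorm ℤ))
    (hΛ : ∀ z ∈ D.L.lattice, ∃ w ∈ periodLattice D.f, z = D.c * w)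
    (hmin : ∀ (W' : WeierstrassCurve ℚ) [W'.IsElliptic]
        (D' : ModularParametrizationData W' (W.conductorNorm ℤ)),
        D'.f = D.f → D.modularDegree ≤ D'.modularDegree)
    (h2 : padicValNat 2 (W.conductorNorm ℤ) = 2) {q : ℕ} (hq : q.Prime) (hq2 : q ≠ 2)
    (hqN : q ∣ W.conductorNorm ℤ) (hq1 : ¬ q ^ 2 ∣ W.conductorNorm ℤ) (hq3 : q % 3 ≠ 2) :
    3 ∣ D.modularDegree := by
  by_contra hnd
  exact hq3 (((h W D hΛ hmin h2 hnd).2 q hq hq2 hqN).2 hq1)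


/-! ### §2. The θ-Brandt module at a PRIME level `M = p` — a computable model over `HurwitzBrandtTwoEisenstein`
(rows E-desc-117 / 118; general odd `M`: definition request D-desc-25) -/

open Summit.BirchSwinnertonDyer.Rank1Residual.ManinAdditive.HurwitzBrandt

/-- `ℤ[ω]` (`ω² + ω + 1 = 0`) as pairs `(a, b) ↔ a + b·ω`; plain functions, no instances (typer lint). [folklore] -/
abbrev ZOmega : Type := ℤ × ℤ

/-- addition in `ℤ[ω]`. [folklore] -/
def ZOmega.add (z w : ZOmega) : ZOmega := (z.1 + w.1, z.2 + w.2)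

/-- multiplication in `ℤ[ω]`: `(a + bω)(c + dω) = (ac − bd) + (ad + bc − bd)ω`. [folklore] -/
def ZOmega.mul (z w : ZOmega) : ZOmega := (z.1 * w.1 - z.2 * w.2, z.1 * w.2 + z.2 * w.1 - z.2 * w.2)

/-- the norm `Nm(a + bω) = a² − ab + b²`. [folklore] -/
def ZOmega.norm (z : ZOmega) : ℤ := z.1 ^ 2 - z.1 * z.2 + z.2 ^ 2

/-- multiplication by `ω^n` (`ω·(a + bω) = −b + (a − b)ω`). [folklore] -/
def ZOmega.omegaPowMul : ℕ → ZOmega → ZOmega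
  | 0, z => z
  | n + 1, z => ZOmega.omegaPowMul n (-z.2, z.1 - z.2)

/-- `θ̃(q) ∈ {0, 1, 2}`: the exponent of the image of the (doubled) Hurwitz quaternion `q = (A,B,C,D)` in
`(O/𝔓)^× = 𝔽₄^× = ⟨w⟩` under `O → O/𝔓 = 𝔽₂[w]`, `i, j, k ↦ 1`, `ζ = (−1+i+j+k)/2 ↦ w`: the image is `s + e·w` with
`s = (A+B+C−D)/2 mod 2`, `e = D mod 2` (junk `0` on `𝔓`, i.e. when `s = e = 0`; never used there: units and elements of
odd norm are prime to `𝔓`).  `θ` is trivial exactly on the units `±1, ±i, ±j, ±k` (`V₄ ⊂ A₄`). [folklore] -/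
def thetaExp (q : DQuat) : ℕ :=
  let s : ℤ := ((q.1 + q.2.1 + q.2.2.1 - q.2.2.2) / 2) % 2
  let e : ℤ := q.2.2.2 % 2
  if e = 0 then 0 else if s = 0 then 1 else 2

/-- `w(x)`: the order of the stabiliser of `x ∈ ℙ¹(𝔽_p)` in `A₄ = O^×/±1` (half the number of the 24 units fixing `x`);
`w(x) ∈ {1, 2}` on the support of `𝓜_θ(p)`, `3 ∣ w(x)` off it. [folklore] -/
def stabWeight (p : ℕ) (x : Fin (p + 1)) : ℕ :=
  (hurwitzUnits.filter fun u => decide (act p u x = x)).length / 2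

/-- θ-EQUIVARIANCE of a point function `g : ℙ¹(𝔽_p) → ℤ[ω]`: `ω^{θ̃(u)} · g(u·x) = g(x)` for all 24 units `u`
(so `g` vanishes at the points with a stabiliser element of order 3).  `𝓜_θ(p)` = the θ-equivariant functions. [folklore] -/
def IsThetaEquivariant (p : ℕ) (g : Fin (p + 1) → ZOmega) : Prop :=
  ∀ u ∈ hurwitzUnits, ∀ x : Fin (p + 1), ZOmega.omegaPowMul (thetaExp u) (g (act p u x)) = g x

/-- PRIMITIVITY of `g` as a `ℤ[ω]`-vector: every common divisor of the values is a unit (in particular `g ≠ 0`). [folklore] -/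
def IsPrimitive (p : ℕ) (g : Fin (p + 1) → ZOmega) : Prop :=
  ∀ d : ZOmega, (∀ x : Fin (p + 1), ∃ c : ZOmega, g x = ZOmega.mul d c) → ZOmega.norm d = 1

/-- the WEIGHTED function `f = W g`, `f(x) = w(x) · g(x)` (divisor side `g` ↔ function side `f`; the Hecke eigen-condition is
imposed on `f`, primitivity and the Gross height are read on `g`). [folklore] -/
def weightMul (p : ℕ) (g : Fin (p + 1) → ZOmega) (x : Fin (p + 1)) : ZOmega :=
  ((stabWeight p x : ℤ) * (g x).1, (stabWeight p x : ℤ) * (g x).2)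

/-- `24 · T_ℓ` on point functions: `(T₂₄ f)(x) = Σ_{γ ∈ O, Nrd γ = ℓ} ω^{θ̃(γ)} · f(γ·x)` (all `24(ℓ+1)` elements of reduced
norm `ℓ`, an odd prime `≠ p`; each left unit coset contributes 24 equal terms, whence the factor 24; preserves
θ-equivariance). [folklore] -/
def thetaHecke24 (p ℓ : ℕ) (f : Fin (p + 1) → ZOmega) (x : Fin (p + 1)) : ZOmega :=
  ((hurwitzOfNorm ℓ).map fun γ => ZOmega.omegaPowMul (thetaExp γ) (f (act p γ x))).foldr ZOmega.add (0, 0)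

/-- `f = W g` is a HECKE EIGENFUNCTION with eigenvalues `a = (a_ℓ)_ℓ`: `T₂₄,ℓ f = 24 a_ℓ · f` for every odd prime `ℓ ≠ p`.
[folklore] -/
def IsThetaHeckeEigen (p : ℕ) (g : Fin (p + 1) → ZOmega) (a : ℕ → ℤ) : Prop :=
  ∀ ℓ : ℕ, ℓ.Prime → ℓ ≠ 2 → ℓ ≠ p → ∀ x : Fin (p + 1),
    thetaHecke24 p ℓ (weightMul p g) x = (24 * a ℓ * (weightMul p g x).1, 24 * a ℓ * (weightMul p g x).2)

/-- TWELVE TIMES THE GROSS HEIGHT: `12 · ⟨m, m⟩ = Σ_{x ∈ ℙ¹(𝔽_p)} w(x)² · Nm g(x)` (on an orbit `o` of size `12 / w_o` the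
values of `g` are unit multiples of `m_o`, so the sum is `12 Σ_o w_o Nm(m_o) = 12 ⟨m, m⟩` in the Gross / Pollack–Weston
normalisation `⟨e_o, e_o⟩ = w_o`). [folklore] -/
def thetaHeightTwelve (p : ℕ) (g : Fin (p + 1) → ZOmega) : ℤ :=
  ((List.finRange (p + 1)).map fun x => (stabWeight p x : ℤ) ^ 2 * ZOmega.norm (g x)).sum

/-- `f = W g` is EISENSTEIN mod `λ = 1 − ω`: `w(x) g(x) ≡ c ≢ 0 (mod λ)` at EVERY point (`a + bω ≡ a + b (mod λ)`); in
particular every orbit is in the support.  (The Eisenstein vector of the divisor-side Brandt action is `o ↦ 1/w_o`.)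
[folklore] -/
def IsEisensteinModLambda (p : ℕ) (g : Fin (p + 1) → ZOmega) : Prop :=
  ∃ c : ℤ, ¬ (3 : ℤ) ∣ c ∧ ∀ x : Fin (p + 1), (3 : ℤ) ∣ (stabWeight p x : ℤ) * ((g x).1 + (g x).2) - c

/-- **MULTIPLICITY ONE at θ-level (construction statement for E-desc-117; nothing asserted).**  For every elliptic curve of
conductor `4p`, `p ≥ 5` prime, the `(a_ℓ(E))`-eigenfunctions of `𝓜_θ(p)` form a free `ℤ[ω]`-module of rank one: a primitive
θ-equivariant `g` with `W g` Hecke-eigen EXISTS and is unique up to the six units.  (Jacquet–Langlands + newform theory for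
the depth-zero supercuspidal at 2; census: an eigenline of rank 1 found at 1717/1717 optimal curves, `M ≤ 1445`.)
[cite: Pizer1980, Thm. 3.13 (shape: Brandt matrices of non-Eichler level 2-adically realise the new space — the θ-isotypic form used here is the cell's, MEMO-desc §35, NOT in print as far as searched)] -/
@[conjecture]
def ThetaBrandtNewLineAtFourPrime : Prop :=
  ∀ (p : ℕ), p.Prime → 5 ≤ p →
  ∀ (W : WeierstrassCurve ℚ) [W.IsElliptic], W.conductorNorm ℤ = 4 * p →
    (∃ g : Fin (p + 1) → ZOmega,
      IsThetaEquivariant p g ∧ IsPrimitive p g ∧ IsThetaHeckeEigen p g fun n => W.LFunction n) ∧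
    ∀ g g' : Fin (p + 1) → ZOmega,
      IsThetaEquivariant p g → IsPrimitive p g → IsThetaHeckeEigen p g (fun n => W.LFunction n) →
      IsThetaEquivariant p g' → IsPrimitive p g' → IsThetaHeckeEigen p g' (fun n => W.LFunction n) →
      ∃ u : ZOmega, ZOmega.norm u = 1 ∧ ∀ x, g' x = ZOmega.mul u (g x)

open scoped Classical in
/-- **Row E-desc-117 `ThetaBrandtDegreeLawAtFourPrime` — THE θ-BRANDT (additive Ribet–Takahashi) DEGREE LAW at prime
`M = p` (LAW; cell bsd-f2-manin, desc g17, MEMO-desc §35; nothing asserted).**  For the `X₀(4p)`-optimal curve `E` (lattice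
clause + minimal-degree clause) and any primitive θ-equivariant Hecke eigenfunction `g` for `(a_ℓ(E))`:
  `deg φ_E = 2^{a(E)} · 3^{1 − t(E)} · ⟨m, m⟩`, cleared of denominators as
  `2^{[IV* ∧ E(ℚ)[2] ≠ 0] + 2} · 3^{t(E)} · deg φ_E = 2^{[IV* ∧ E(ℚ)[2] = 0]} · (12 ⟨m, m⟩)`,
`t(E) = [IsThreeEisensteinDegenerateAtFour E]`.  Census (BC5 witness, all odd `M ≤ 1445`, prime or not): 1717 / 1717, see the
module docstring; prime `M = p ≤ 1429`: every optimal curve of conductor `4p` in that range.  Why it might fail: (2-part) a IV*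
optimal curve at a Gaussian prime level `4p`, `p ≡ 1 (mod 4)`, with `E[2]` irreducible and `u_s` separable (the THEOREM L
(iii) loophole, D-desc-22: none among the 19 + all prime cases of the census); (3-part) an Eisenstein-mod-`λ` eigenvector whose
congruence is not explained by a torsion point in `E⁰` (none: E-desc-118, 216/216 + 150/150); (prime-to-6 part) a congruence
between `f_E` and another θ-newform invisible in `X₀(4p)` — impossible if `𝓜_θ ⊗ ℚ ≅ S₂^{new}` is a Hecke isomorphism and
the usual Ribet exact-sequence argument transfers (the additive Ribet–Takahashi comparison, OPEN).
[cite: PollackWeston2011, Thm. 6.8 with Prop. 6.7 (tree `PollackWeston2011.thm_6_8_ellipticCurve`: the squarefree-level formula ord_p δ_f = ord_p ξ_f + Σ t_f(q) whose additive analogue at the supercuspidal prime 2 this row is — NOT in print)]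
[cite: Takahashi2001, Thm. 2.3 (tree `takahashi2001_thm_2_3_of_coprime`: Eichler level, toric primes)]
[cite: Gross1987Heights, §§1–4 (heights ⟨e_i,e_j⟩ = δ_ij w_i on the Brandt module and special values; prime level, trivial character)] -/
@[conjecture]
def ThetaBrandtDegreeLawAtFourPrime : Prop :=
  ∀ (p : ℕ), p.Prime → 5 ≤ p →
  ∀ (W : WeierstrassCurve ℚ) [W.IsElliptic] [W.IsGloballyMinimal] [NeZero (W.conductorNorm ℤ)]
    (D : ModularParametrizationData W (W.conductorNorm ℤ)),
    W.conductorNorm ℤ = 4 * p →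
    (∀ z ∈ D.L.lattice, ∃ w ∈ periodLattice D.f, z = D.c * w) →
    (∀ (W' : WeierstrassCurve ℚ) [W'.IsElliptic]
        (D' : ModularParametrizationData W' (W.conductorNorm ℤ)),
        D'.f = D.f → D.modularDegree ≤ D'.modularDegree) →
  ∀ g : Fin (p + 1) → ZOmega,
    IsThetaEquivariant p g → IsPrimitive p g → IsThetaHeckeEigen p g (fun n => W.LFunction n) →
    (2 : ℤ) ^ ((if IsTypeFourStarAtTwoTame W ∧ HasRationalTwoTorsion W then 1 else 0) + 2) *
        3 ^ (if IsThreeEisensteinDegenerateAtFour W then 1 else 0) * (D.modularDegree : ℤ) =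
      2 ^ (if IsTypeFourStarAtTwoTame W ∧ ¬ HasRationalTwoTorsion W then 1 else 0) * thetaHeightTwelve p g

/-- **Row E-desc-118 `ThetaEisensteinCriterionAtFourPrime` (LAW, the E-blind form of `t(E)`; desc g17, MEMO-desc §35;
nothing asserted).**  Under the hypotheses of E-desc-117 the curve is 3-Eisenstein-degenerate iff its θ-Brandt eigenvector is
Eisenstein mod `λ`.  Census: all 216 optimal curves with `3 ∣ #E(ℚ)_tors` (20 degenerate ⟷ 20 Eisenstein mod λ, 196 ⟷ 196 not)
and the 150 optimal curves with a rational 3-isogeny but no 3-torsion (`M ≤ 1445`), `eis3.py`.  Why it might fail: a curve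
with a rational 3-isogeny whose kernel is `μ₃`-like and whose eigenvector is nevertheless Eisenstein mod `λ` at every point.
[cite: Mazur1977, Prop. II.9.7 and §II.16 (shape: Eisenstein congruences of weight-2 forms at prime level ↔ rational torsion; the θ-level criterion is the cell's E-desc-118, NOT in print)] -/
@[conjecture]
def ThetaEisensteinCriterionAtFourPrime : Prop :=
  ∀ (p : ℕ), p.Prime → 5 ≤ p →
  ∀ (W : WeierstrassCurve ℚ) [W.IsElliptic] [W.IsGloballyMinimal] [NeZero (W.conductorNorm ℤ)]
    (D : ModularParametrizationData W (W.conductorNorm ℤ)),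
    W.conductorNorm ℤ = 4 * p →
    (∀ z ∈ D.L.lattice, ∃ w ∈ periodLattice D.f, z = D.c * w) →
    (∀ (W' : WeierstrassCurve ℚ) [W'.IsElliptic]
        (D' : ModularParametrizationData W' (W.conductorNorm ℤ)),
        D'.f = D.f → D.modularDegree ≤ D'.modularDegree) →
  ∀ g : Fin (p + 1) → ZOmega,
    IsThetaEquivariant p g → IsPrimitive p g → IsThetaHeckeEigen p g (fun n => W.LFunction n) →
    (IsThreeEisensteinDegenerateAtFour W ↔ IsEisensteinModLambda p g)

end Summit.BirchSwinnertonDyer.Rank1Residual.ManinAdditive.ThetaBrandt
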